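import Summits.SmoothPoincare4.SmoothPoincare4.Theorems.EntropyRungBakryEmeryLogSobolevGradientDissipation
import HarnessLib

/-!
# Gradient decay `|∇ρ(s)|² ≤ e^{-2Ks} sup|∇ρ₀|²` for `𝕃²` solutions of the weighted heat flow on a
# complete `CD(K, ∞)` manifold, with first-order (Gaffney) cut-offs
# (support item `EntropyRung.BakryEmeryLogSobolev`, stmt-SmoothPoincare4-16587)

Setting: `M` modelled on `ℝⁿ` (Hausdorff, second countable, `T₃`, Borel — NOT compact), `g`
Riemannian with its Levi-Civita connection, `V` smooth with `Ric + Hess V ≥ K g` (NO other assumption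
on `V`), `L = Δ_g − g⁻¹(dV, d·)`; Gaffney cut-offs `η_k` (`0 ≤ η_k ≤ 1`, `η_k ≤ η_{k+1}`, `η_k(x) = 1`
for large `k`, `|∇η_k|² ≤ C₀/(k+1)²`, `exists_gaffney_cutoff`).

**Theorem** (`gaffney_gradientDecay`). A solution `ρ` of `∂ₛρ = Lρ` on `[0, T]`, smooth on `M × O`
(`O ⊇ [0,T]` open), of finite energy `|∇ρ|² e^{-V} ∈ L¹(M × (0,T))`, with `|∇ρ(0)|² ≤ G₀`, satisfies
`|∇ρ(s)|² ≤ e^{-2Ks} G₀` on `[0, T]`: the energy method for the subsolution `w = e^{2Ks}|∇ρ|² − G₀`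
(`∂ₛw − Lw = −2e^{2Ks} S` with the `Γ₂`-slack `S`) with the linear test function of `exists_convexTest`
and weights `η_k² e^{-V}`, the cut-off error being absorbed into `S`
(`integral_gradTest_dissipation_le`, `EntropyRungBakryEmeryLogSobolevGradientDissipation.lean`), so that
`0 ≤ E_k(s) ≤ 2e^{2|K|T} C₀/(k+1)² ∫∫|∇ρ|² e^{-V} → 0`, `E_k` nondecreasing in `k` — the weak Bakry–Émery
commutation `Γ(P_t f) ≤ e^{-2Kt}‖Γf‖_∞` for the minimal heat flow. Everything is proved; no definitions.

## References

* [BakryGentilLedoux2014] D. Bakry, I. Gentil, M. Ledoux (2014), Thm. 3.2.3/3.2.4 and their proofs,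
  pp. 143–147 (gradient bounds on a complete manifold through cut-offs `ζ_k`, `Γ(ζ_k) ≤ 1/k`), §C.6.
* [CarrilloNi2009] J. A. Carrillo, L. Ni, Comm. Anal. Geom. 17 (2009), §3 (p. 8) and §4.
-/

noncomputable section

set_option linter.dupNamespace false

open scoped Manifold ContDiff ENNReal NNReal Topology
open MeasureTheory Set Filter
open Literature.Geometry.Lorentzian Literature.Geometry.Riemannian

namespace Summit.SmoothPoincare4.SmoothPoincare4.Theorems.BakryEmeryComplete

open NoncompactShrinkerGapHeat NoncompactShrinkerGapHeat.CutoffToolkit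

section Gradient

variable {n : ℕ} {M : Type*} [TopologicalSpace M] [T2Space M] [SecondCountableTopology M]
  [ChartedSpace (EuclideanSpace ℝ (Fin n)) M] [IsManifold (𝓡 n) ∞ M] [T3Space M]
  [MeasurableSpace M] [BorelSpace M]
  {g : PseudoRiemannianMetric (𝓡 n) ∞ (EuclideanSpace ℝ (Fin n)) (TangentSpace (𝓡 n) : M → Type _)}
  [g.HasLeviCivita]

/-- **Gradient decay for finite-energy solutions of the weighted heat flow on a complete `CD(K,∞)`
manifold, with Gaffney cut-offs.** `Ric + Hess V ≥ K g`, `V` smooth (no other assumption); `η_k` as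
in `exists_gaffney_cutoff`; `ρ` smooth on `M × O` (`O ⊇ [0,T]` open) with `∂ₛρ = Lρ` on `[0, T]`,
`|∇ρ|² e^{-V}` integrable on the strip `M × (0,T)` and `|∇ρ(0)|² ≤ G₀`. Then
`|∇ρ(s)|² ≤ e^{-2Ks} G₀` on `[0, T]`. Energy method for `w = e^{2Ks}|∇ρ|² − G₀` with the linear test
function of `exists_convexTest` and weights `η_k² e^{-V}`: `∂ₛw − Lw = −2e^{2Ks}S` with the
`Γ₂`-slack `S`, and the cut-off error is absorbed into `S` (`integral_gradTest_dissipation_le`), so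
`0 ≤ E_k(s) ≤ 2e^{2|K|T} C₀/(k+1)² ∫∫ |∇ρ|² e^{-V} → 0`. This is the (weak) Bakry–Émery commutation
`Γ(P_t f) ≤ e^{-2Kt} ‖Γ f‖_∞` for the minimal heat flow.
[cite: BakryGentilLedoux2014, Thm. 3.2.3 and Thm. 3.2.4 (proofs, pp. 143–147)]
[cite: CarrilloNi2009, §3 (C(K,∞), p. 8)] -/
theorem gaffney_gradientDecay (hg : g.IsRiemannian) {V : M → ℝ} {K : ℝ}
    (hV : ContMDiff (𝓡 n) 𝓘(ℝ, ℝ) ∞ V)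
    (hRic : ∀ (y : M) (X : TangentSpace (𝓡 n) y), K * g.val y X X ≤ g.ricci y X X + g.hessian V y X X)
    {η : ℕ → M → ℝ} {C₀ : ℝ} (hηs : ∀ k, ContMDiff (𝓡 n) 𝓘(ℝ, ℝ) ∞ (η k))
    (hηc : ∀ k, HasCompactSupport (η k)) (hη01 : ∀ k x, 0 ≤ η k x ∧ η k x ≤ 1)
    (hηmono : ∀ k x, η k x ≤ η (k + 1) x) (hη1 : ∀ x, ∀ᶠ k in atTop, η k x = 1)
    (hηgrad : ∀ k x, g.gradSq (η k) x ≤ C₀ / ((k : ℝ) + 1) ^ 2)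
    {T : ℝ} {O : Set ℝ} {ρ : ℝ → M → ℝ} (hO : IsOpen O) (hTO : Icc 0 T ⊆ O)
    (hρ : ContMDiffOn ((𝓡 n).prod 𝓘(ℝ, ℝ)) 𝓘(ℝ, ℝ) ∞ (fun p : M × ℝ ↦ ρ p.2 p.1) (univ ×ˢ O))
    (heq : ∀ s ∈ Icc 0 T, ∀ x, deriv (fun r ↦ ρ r x) s = g.dalembertian (ρ s) x
      - g.innerDual x (mvfderiv (𝓡 n) V x).toLinearMap (mvfderiv (𝓡 n) (ρ s) x).toLinearMap)
    (hint : Integrable (fun p : M × ℝ ↦ g.gradSq (ρ p.2) p.1 * Real.exp (-V p.1))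
      ((g.riemVolume.prod (volume : Measure ℝ)).restrict (univ ×ˢ Ioo 0 T)))
    {G₀ : ℝ} (hG₀ : ∀ x, g.gradSq (ρ 0) x ≤ G₀) :
    ∀ s ∈ Icc 0 T, ∀ x, g.gradSq (ρ s) x ≤ Real.exp (-2 * K * s) * G₀ := by
  intro s₀ hs₀ x₀
  -- topology and measure
  haveI : LocallyCompactSpace M := Manifold.locallyCompact_of_finiteDimensional (M := M) (𝓡 n)
  haveI : IsFiniteMeasureOnCompacts g.riemVolume := CarrilloNi2009_shrinkerLSI.isFiniteMeasureOnCompacts_riemVolume hg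
  haveI : IsLocallyFiniteMeasure g.riemVolume := isLocallyFiniteMeasure_of_isFiniteMeasureOnCompacts
  haveI : g.riemVolume.IsOpenPosMeasure := isOpenPosMeasure_riemVolume hg
  haveI := sigmaFinite_riemVolume hg
  set μ : Measure M := g.riemVolume with hμ
  -- the test function (linear growth)
  obtain ⟨Ψ, hΨs, hΨneg, hΨ', hΨ'', hΨbd, hΨzero⟩ := exists_convexTest
  have hΨd : ∀ t, HasDerivAt Ψ (deriv Ψ t) t := fun t ↦ (hΨs.differentiable (by simp) t).hasDerivAt
  have hΨc : Continuous Ψ := hΨs.continuous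
  have hΨ'c : Continuous (deriv Ψ) := hΨs.continuous_deriv (by simp)
  -- the subsolution `w(s, x) = e^{2Ks}|∇ρ(s)|²(x) − G₀`
  set ex : ℝ → ℝ := fun s ↦ Real.exp (2 * K * s) with hex
  have hexd : ∀ s, HasDerivAt ex (2 * K * ex s) s := fun s ↦ by
    have h1 : HasDerivAt (fun r : ℝ ↦ 2 * K * r) (2 * K) s := by
      simpa using (hasDerivAt_id s).const_mul (2 * K)
    simpa [hex, mul_comm] using h1.exp
  have hex0 : ∀ s, 0 ≤ ex s := fun s ↦ (Real.exp_pos _).le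
  have hexT : ∀ s ∈ Icc 0 T, ex s ≤ Real.exp (2 * |K| * T) := fun s hs ↦ by
    refine Real.exp_le_exp.2 ?_
    have h1 : 2 * K * s ≤ 2 * |K| * s := by nlinarith [le_abs_self K, hs.1]
    have h2 : 2 * |K| * s ≤ 2 * |K| * T := by nlinarith [abs_nonneg K, hs.2]
    linarith
  set Q : ℝ → M → ℝ := fun s x ↦ g.gradSq (ρ s) x with hQdef
  set w : ℝ → M → ℝ := fun s x ↦ ex s * Q s x + -G₀ with hwdef
  have hQj : ContMDiffOn ((𝓡 n).prod 𝓘(ℝ, ℝ)) 𝓘(ℝ, ℝ) ∞ (fun p : M × ℝ ↦ Q p.2 p.1) (univ ×ˢ O) :=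
    contMDiffOn_gradSq_family g hO.uniqueDiffOn hρ
  have hexj : ContMDiffOn ((𝓡 n).prod 𝓘(ℝ, ℝ)) 𝓘(ℝ, ℝ) ∞ (fun p : M × ℝ ↦ ex p.2) (univ ×ˢ O) := by
    have h : ContDiff ℝ ∞ ex := Real.contDiff_exp.comp (contDiff_const.mul contDiff_id)
    exact (h.comp_contMDiff contMDiff_snd).contMDiffOn
  have hwj : ContMDiffOn ((𝓡 n).prod 𝓘(ℝ, ℝ)) 𝓘(ℝ, ℝ) ∞ (fun p : M × ℝ ↦ w p.2 p.1) (univ ×ˢ O) :=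
    (hexj.mul hQj).add contMDiffOn_const
  have hρs : ∀ s ∈ O, ContMDiff (𝓡 n) 𝓘(ℝ, ℝ) ∞ (ρ s) := fun s hs ↦ contMDiff_slice_of_contMDiffOn hρ hs
  have hws : ∀ s ∈ O, ContMDiff (𝓡 n) 𝓘(ℝ, ℝ) ∞ (w s) := fun s hs ↦ contMDiff_slice_of_contMDiffOn hwj hs
  have hwc : ContinuousOn (fun p : M × ℝ ↦ w p.2 p.1) (univ ×ˢ O) := hwj.continuousOn
  have hw'c : ContinuousOn (fun p : M × ℝ ↦ deriv (fun r ↦ w r p.1) p.2) (univ ×ˢ O) := continuousOn_deriv_time hO hwj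
  -- the time derivative of `w` on `[0, T]`
  have hQderiv : ∀ s ∈ Icc 0 T, ∀ x, deriv (fun r ↦ Q r x) s =
      2 * g.innerDual x (mvfderiv (𝓡 n) (ρ s) x).toLinearMap
        (mvfderiv (𝓡 n) (fun y ↦ g.dalembertian (ρ s) y -
          g.innerDual y (mvfderiv (𝓡 n) V y).toLinearMap (mvfderiv (𝓡 n) (ρ s) y).toLinearMap) x).toLinearMap :=
    fun s hs x ↦ deriv_gradSq_of_heatFlow_isOpen hV hO hρ (hTO hs) (heq s hs) x
  have hwderiv : ∀ s ∈ Icc 0 T, ∀ x, deriv (fun r ↦ w r x) s =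
      2 * K * ex s * Q s x + ex s * (2 * g.innerDual x (mvfderiv (𝓡 n) (ρ s) x).toLinearMap
        (mvfderiv (𝓡 n) (fun y ↦ g.dalembertian (ρ s) y -
          g.innerDual y (mvfderiv (𝓡 n) V y).toLinearMap (mvfderiv (𝓡 n) (ρ s) y).toLinearMap) x).toLinearMap) := by
    intro s hs x
    have hQd : HasDerivAt (fun r ↦ Q r x) (deriv (fun r ↦ Q r x) s) s := hasDerivAt_time hO hQj x (hTO hs)
    have h := ((hexd s).mul hQd).add_const (-G₀)
    have e : (fun r ↦ w r x) = fun r ↦ (ex * fun r' ↦ Q r' x) r + -G₀ := rfl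
    rw [e, h.deriv, hQderiv s hs x]
  -- the integrands `F = Ψ(w)`, `F' = Ψ'(w) ∂ₛw`
  set F : ℝ → M → ℝ := fun s x ↦ Ψ (w s x) with hF
  set F' : ℝ → M → ℝ := fun s x ↦ deriv Ψ (w s x) * deriv (fun r ↦ w r x) s with hF'
  have hFc : ContinuousOn (fun p : M × ℝ ↦ F p.2 p.1) (univ ×ˢ O) := hΨc.comp_continuousOn hwc
  have hF'c : ContinuousOn (fun p : M × ℝ ↦ F' p.2 p.1) (univ ×ˢ O) := (hΨ'c.comp_continuousOn hwc).mul hw'c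
  have hFd : ∀ s ∈ O, ∀ x, HasDerivAt (F · x) (F' s x) s := fun s hs x ↦
    (hΨd (w s x)).comp s (hasDerivAt_time hO hwj x hs)
  -- weights, energies, error terms
  have hexpc : Continuous fun x ↦ Real.exp (-V x) := Real.continuous_exp.comp hV.continuous.neg
  have hη2c : ∀ k, HasCompactSupport (fun x ↦ η k x ^ 2) := fun k ↦ by
    rw [show (fun x ↦ η k x ^ 2) = fun x ↦ η k x * η k x from funext fun x ↦ sq (η k x)]
    exact (hηc k).mul_right
  set h : ℕ → M → ℝ := fun k x ↦ η k x ^ 2 * Real.exp (-V x) with hh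
  have hhc : ∀ k, Continuous (h k) := fun k ↦ ((hηs k).continuous.pow 2).mul hexpc
  have hhs : ∀ k, HasCompactSupport (h k) := fun k ↦ (hη2c k).mul_right
  have hh0 : ∀ k x, 0 ≤ h k x := fun k x ↦ mul_nonneg (sq_nonneg _) (Real.exp_pos _).le
  have hgradηc : ∀ k, Continuous (g.gradSq (η k)) := fun k ↦ (contMDiff_gradSq g (hηs k)).continuous
  have hgradηs : ∀ k, HasCompactSupport (g.gradSq (η k)) := fun k ↦ .intro (hηc k) fun x hx ↦ gradSq_eq_zero_of_notMem_tsupport hx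
  set wZ : ℕ → M → ℝ := fun k x ↦ g.gradSq (η k) x * Real.exp (-V x) with hwZ
  have hwZc : ∀ k, Continuous (wZ k) := fun k ↦ (hgradηc k).mul hexpc
  have hwZs : ∀ k, HasCompactSupport (wZ k) := fun k ↦ (hgradηs k).mul_right
  set E : ℕ → ℝ → ℝ := fun k s ↦ ∫ x, F s x * h k x ∂μ with hE
  set E' : ℕ → ℝ → ℝ := fun k s ↦ ∫ x, F' s x * h k x ∂μ with hE'
  set Z : ℕ → ℝ → ℝ := fun k s ↦ ∫ x, Q s x * wZ k x ∂μ with hZdef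
  have hEd : ∀ k, ∀ s ∈ O, HasDerivAt (E k) (E' k s) s := fun k s hs ↦
    hasDerivAt_integral_mul_of_hasCompactSupport μ (hhc k) (hhs k) hO hFc hF'c hFd hs
  have hE'c : ∀ k, ContinuousOn (E' k) O := fun k ↦ continuousOn_integral_mul_of_hasCompactSupport μ (hhc k) (hhs k) hF'c
  have hZc : ∀ k, ContinuousOn (Z k) O := fun k ↦
    continuousOn_integral_mul_of_hasCompactSupport μ (hwZc k) (hwZs k) hQj.continuousOn
  have hZ0 : ∀ k s, 0 ≤ Z k s := fun k s ↦ integral_nonneg fun x ↦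
    mul_nonneg (g.gradSq_nonneg hg _ _) (mul_nonneg (g.gradSq_nonneg hg _ _) (Real.exp_pos _).le)
  -- the dissipation bound `E' k s ≤ 2 e^{2|K|T} Z k s` on `[0, T]`
  set CT : ℝ := Real.exp (2 * |K| * T) with hCT
  have hE'le : ∀ k, ∀ s ∈ Icc 0 T, E' k s ≤ 2 * CT * Z k s := by
    intro k s hs
    have hsO := hTO hs
    have step := integral_gradTest_dissipation_le hg hV hRic (hρs s hsO) (hηs k) (hηc k) hΨs
      (fun t ↦ (hΨ' t).1) hΨ'' (hex0 s) G₀ (K := K)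
    -- `E' k s` is the left-hand side of `step`
    have hLc : ∀ x, deriv (fun r ↦ w r x) s =
        (g.dalembertian (w s) x - g.innerDual x (mvfderiv (𝓡 n) V x).toLinearMap
          (mvfderiv (𝓡 n) (w s) x).toLinearMap)
        + ex s * (2 * K * Q s x
          + 2 * g.innerDual x (mvfderiv (𝓡 n) (ρ s) x).toLinearMap
            (mvfderiv (𝓡 n) (fun y ↦ g.dalembertian (ρ s) y
              - g.innerDual y (mvfderiv (𝓡 n) V y).toLinearMap (mvfderiv (𝓡 n) (ρ s) y).toLinearMap)
              x).toLinearMap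
          - (g.dalembertian (Q s) x - g.innerDual x (mvfderiv (𝓡 n) V x).toLinearMap
              (mvfderiv (𝓡 n) (Q s) x).toLinearMap)) := by
      intro x
      have hQ2 : ContMDiffAt (𝓡 n) 𝓘(ℝ, ℝ) 2 (Q s) x :=
        ((contMDiff_gradSq g (hρs s hsO)).of_le (WithTop.coe_le_coe.mpr le_top)).contMDiffAt
      have haff := weightedLaplacian_affine (g := g) (V := V) hQ2 (ex s) (-G₀)
      rw [hwderiv s hs x, show w s = fun y ↦ ex s * Q s y + -G₀ from rfl, haff]
      ring
    have e1 : E' k s = (∫ x, deriv Ψ (ex s * g.gradSq (ρ s) x + -G₀) * η k x ^ 2 *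
        (g.dalembertian (fun y ↦ ex s * g.gradSq (ρ s) y + -G₀) x
          - g.innerDual x (mvfderiv (𝓡 n) V x).toLinearMap
            (mvfderiv (𝓡 n) (fun y ↦ ex s * g.gradSq (ρ s) y + -G₀) x).toLinearMap) * Real.exp (-V x) ∂μ)
      + ∫ x, deriv Ψ (ex s * g.gradSq (ρ s) x + -G₀) * η k x ^ 2 *
          (ex s * (2 * K * g.gradSq (ρ s) x
            + 2 * g.innerDual x (mvfderiv (𝓡 n) (ρ s) x).toLinearMap
              (mvfderiv (𝓡 n) (fun y ↦ g.dalembertian (ρ s) y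
                - g.innerDual y (mvfderiv (𝓡 n) V y).toLinearMap (mvfderiv (𝓡 n) (ρ s) y).toLinearMap)
                x).toLinearMap
            - (g.dalembertian (g.gradSq (ρ s)) x - g.innerDual x (mvfderiv (𝓡 n) V x).toLinearMap
                (mvfderiv (𝓡 n) (g.gradSq (ρ s)) x).toLinearMap))) * Real.exp (-V x) ∂μ := by
      have h1le : (1 : ℕ∞ω) ≤ (∞ : ℕ∞ω) := WithTop.coe_le_coe.mpr le_top
      have h2le : (2 : ℕ∞ω) ≤ (∞ : ℕ∞ω) := WithTop.coe_le_coe.mpr le_top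
      have hwss := hws s hsO
      have hρss := hρs s hsO
      have hQs : ContMDiff (𝓡 n) 𝓘(ℝ, ℝ) ∞ (Q s) := contMDiff_gradSq g hρss
      have hψwc : Continuous fun x ↦ deriv Ψ (w s x) := hΨ'c.comp hwss.continuous
      have hLwc : Continuous fun x ↦ g.dalembertian (w s) x - g.innerDual x
          (mvfderiv (𝓡 n) V x).toLinearMap (mvfderiv (𝓡 n) (w s) x).toLinearMap :=
        (continuous_dalembertian g (hwss.of_le h2le)).sub
          (continuous_innerDual_mvfderiv g (hV.of_le h1le) (hwss.of_le h1le))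
      have hLρss : ContMDiff (𝓡 n) 𝓘(ℝ, ℝ) ∞ (fun y ↦ g.dalembertian (ρ s) y
          - g.innerDual y (mvfderiv (𝓡 n) V y).toLinearMap (mvfderiv (𝓡 n) (ρ s) y).toLinearMap) :=
        (contMDiff_dalembertian g hρss).sub (contMDiff_innerDual g hV hρss)
      have hI3c : Continuous fun x ↦ g.innerDual x (mvfderiv (𝓡 n) (ρ s) x).toLinearMap
          (mvfderiv (𝓡 n) (fun y ↦ g.dalembertian (ρ s) y
            - g.innerDual y (mvfderiv (𝓡 n) V y).toLinearMap (mvfderiv (𝓡 n) (ρ s) y).toLinearMap)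
            x).toLinearMap := continuous_innerDual_mvfderiv g (hρss.of_le h1le) (hLρss.of_le h1le)
      have hLQc : Continuous fun x ↦ g.dalembertian (Q s) x - g.innerDual x
          (mvfderiv (𝓡 n) V x).toLinearMap (mvfderiv (𝓡 n) (Q s) x).toLinearMap :=
        (continuous_dalembertian g (hQs.of_le h2le)).sub
          (continuous_innerDual_mvfderiv g (hV.of_le h1le) (hQs.of_le h1le))
      have hsrcc : Continuous fun x ↦ ex s * (2 * K * Q s x
          + 2 * g.innerDual x (mvfderiv (𝓡 n) (ρ s) x).toLinearMap
            (mvfderiv (𝓡 n) (fun y ↦ g.dalembertian (ρ s) y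
              - g.innerDual y (mvfderiv (𝓡 n) V y).toLinearMap (mvfderiv (𝓡 n) (ρ s) y).toLinearMap)
              x).toLinearMap
          - (g.dalembertian (Q s) x - g.innerDual x (mvfderiv (𝓡 n) V x).toLinearMap
              (mvfderiv (𝓡 n) (Q s) x).toLinearMap)) :=
        continuous_const.mul (((continuous_const.mul hQs.continuous).add
          (continuous_const.mul hI3c)).sub hLQc)
      have i1 : Integrable (fun x ↦ deriv Ψ (w s x) * η k x ^ 2 * (g.dalembertian (w s) x
          - g.innerDual x (mvfderiv (𝓡 n) V x).toLinearMap (mvfderiv (𝓡 n) (w s) x).toLinearMap) *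
          Real.exp (-V x)) μ :=
        integrable_of_continuous_of_hasCompactSupport' hg
          (((hψwc.mul ((hηs k).continuous.pow 2)).mul hLwc).mul hexpc)
          ((((hη2c k).mul_left).mul_right).mul_right)
      have i2 : Integrable (fun x ↦ deriv Ψ (w s x) * η k x ^ 2 * (ex s * (2 * K * Q s x
          + 2 * g.innerDual x (mvfderiv (𝓡 n) (ρ s) x).toLinearMap
            (mvfderiv (𝓡 n) (fun y ↦ g.dalembertian (ρ s) y
              - g.innerDual y (mvfderiv (𝓡 n) V y).toLinearMap (mvfderiv (𝓡 n) (ρ s) y).toLinearMap)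
              x).toLinearMap
          - (g.dalembertian (Q s) x - g.innerDual x (mvfderiv (𝓡 n) V x).toLinearMap
              (mvfderiv (𝓡 n) (Q s) x).toLinearMap))) * Real.exp (-V x)) μ :=
        integrable_of_continuous_of_hasCompactSupport' hg
          (((hψwc.mul ((hηs k).continuous.pow 2)).mul hsrcc).mul hexpc)
          ((((hη2c k).mul_left).mul_right).mul_right)
      rw [← integral_add i1 i2]
      refine integral_congr_ae (Eventually.of_forall fun x ↦ ?_)
      simp only [hF', hh, hLc x]
      ring
    have e2 : 2 * CT * Z k s ≥ 2 * ex s * ∫ x, deriv Ψ (ex s * g.gradSq (ρ s) x + -G₀) *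
        (g.gradSq (η k) x * g.gradSq (ρ s) x) * Real.exp (-V x) ∂μ := by
      have hZ1 : ∫ x, deriv Ψ (ex s * g.gradSq (ρ s) x + -G₀) *
          (g.gradSq (η k) x * g.gradSq (ρ s) x) * Real.exp (-V x) ∂μ ≤ Z k s := by
        have hρss := hρs s hsO
        have hψwc : Continuous fun x ↦ deriv Ψ (w s x) := hΨ'c.comp (hws s hsO).continuous
        have i3 : Integrable (fun x ↦ deriv Ψ (ex s * g.gradSq (ρ s) x + -G₀) *
            (g.gradSq (η k) x * g.gradSq (ρ s) x) * Real.exp (-V x)) μ :=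
          integrable_of_continuous_of_hasCompactSupport' hg
            ((hψwc.mul ((hgradηc k).mul (contMDiff_gradSq g hρss).continuous)).mul hexpc)
            ((((hgradηs k).mul_right).mul_left).mul_right)
        have i4 : Integrable (fun x ↦ Q s x * wZ k x) μ :=
          integrable_of_continuous_of_hasCompactSupport' hg
            ((contMDiff_gradSq g hρss).continuous.mul (hwZc k)) ((hwZs k).mul_left)
        refine integral_mono i3 i4 fun x ↦ ?_
        have hq : 0 ≤ g.gradSq (η k) x * g.gradSq (ρ s) x * Real.exp (-V x) :=
          mul_nonneg (mul_nonneg (g.gradSq_nonneg hg _ _) (g.gradSq_nonneg hg _ _)) (Real.exp_pos _).le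
        have h1 := (hΨ' (ex s * g.gradSq (ρ s) x + -G₀)).2
        calc deriv Ψ (ex s * g.gradSq (ρ s) x + -G₀) * (g.gradSq (η k) x * g.gradSq (ρ s) x) *
              Real.exp (-V x)
            = deriv Ψ (ex s * g.gradSq (ρ s) x + -G₀) *
                (g.gradSq (η k) x * g.gradSq (ρ s) x * Real.exp (-V x)) := by ring
          _ ≤ 1 * (g.gradSq (η k) x * g.gradSq (ρ s) x * Real.exp (-V x)) :=
              mul_le_mul_of_nonneg_right h1 hq
          _ = Q s x * wZ k x := by simp only [hQdef, hwZ]; ring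
      have hI0 : 0 ≤ ∫ x, deriv Ψ (ex s * g.gradSq (ρ s) x + -G₀) *
          (g.gradSq (η k) x * g.gradSq (ρ s) x) * Real.exp (-V x) ∂μ :=
        integral_nonneg fun x ↦ mul_nonneg (mul_nonneg (hΨ' _).1
          (mul_nonneg (g.gradSq_nonneg hg _ _) (g.gradSq_nonneg hg _ _))) (Real.exp_pos _).le
      have h3 : 2 * ex s ≤ 2 * CT := by linarith [hexT s hs]
      nlinarith [mul_le_mul h3 hZ1 hI0 (by positivity), hZ0 k s]
    rw [e1]
    exact step.trans e2
  -- integrating in time: `E k s₀ ≤ 2 CT C₀/(k+1)² B`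
  set ν : Measure (M × ℝ) := (μ.prod (volume : Measure ℝ)).restrict (univ ×ˢ Ioo 0 T) with hν
  set B : ℝ := ∫ p, g.gradSq (ρ p.2) p.1 * Real.exp (-V p.1) ∂ν with hB
  have hB0 : 0 ≤ B := integral_nonneg fun p ↦ mul_nonneg (g.gradSq_nonneg hg _ _) (Real.exp_pos _).le
  have hCT0 : 0 ≤ CT := (Real.exp_pos _).le
  have hCk : ∀ k : ℕ, 0 ≤ C₀ / ((k : ℝ) + 1) ^ 2 := fun k ↦ (g.gradSq_nonneg hg _ x₀).trans (hηgrad k x₀)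
  have hE0 : ∀ k, E k 0 = 0 := fun k ↦ by
    refine integral_eq_zero_of_ae (ae_of_all _ fun x ↦ ?_)
    have hw0 : w 0 x ≤ 0 := by
      simp only [hwdef, hQdef, hex, mul_zero, Real.exp_zero, one_mul]
      linarith [hG₀ x]
    simp [hF, hΨneg _ hw0]
  have hEbound : ∀ k, E k s₀ ≤ 2 * CT * (C₀ / ((k : ℝ) + 1) ^ 2 * B) := by
    intro k
    rcases eq_or_lt_of_le hs₀.1 with h0 | hpos
    · rw [← h0, hE0 k]
      exact mul_nonneg (mul_nonneg (by norm_num) hCT0) (mul_nonneg (hCk k) hB0)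
    · have hIcc : Icc 0 s₀ ⊆ O := fun s hs ↦ hTO ⟨hs.1, hs.2.trans hs₀.2⟩
      have hderiv : ∀ s ∈ uIcc 0 s₀, HasDerivAt (E k) (E' k s) s := by
        intro s hs
        rw [uIcc_of_le hs₀.1] at hs
        exact hEd k s (hIcc hs)
      have hE'i : IntervalIntegrable (E' k) volume 0 s₀ :=
        ((hE'c k).mono (by rw [uIcc_of_le hs₀.1]; exact hIcc)).intervalIntegrable
      have hZi : IntervalIntegrable (Z k) volume 0 s₀ :=
        ((hZc k).mono (by rw [uIcc_of_le hs₀.1]; exact hIcc)).intervalIntegrable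
      have hZi2 : IntervalIntegrable (fun s ↦ 2 * CT * Z k s) volume 0 s₀ := hZi.const_mul (2 * CT)
      have hFTC := intervalIntegral.integral_eq_sub_of_hasDerivAt hderiv hE'i
      -- Fubini on the strip `M × (0, s₀)` for `Z k`, then compare with `B`
      set ν' : Measure (M × ℝ) := (μ.prod (volume : Measure ℝ)).restrict (univ ×ˢ Ioo 0 s₀) with hν'
      have hZF : ∫ p, Q p.2 p.1 * wZ k p.1 ∂ν' = ∫ s in (0 : ℝ)..s₀, Z k s :=
        integral_strip_eq_intervalIntegral μ hs₀.1
          (integrable_strip_mul_of_hasCompactSupport μ (hQj.continuousOn.mono (prod_mono le_rfl hIcc))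
            (hwZc k) (hwZs k))
      have hsub : (univ : Set M) ×ˢ Ioo (0 : ℝ) s₀ ⊆ (univ : Set M) ×ˢ Ioo 0 T :=
        prod_mono le_rfl (Ioo_subset_Ioo le_rfl hs₀.2)
      have hint' : Integrable (fun p : M × ℝ ↦ g.gradSq (ρ p.2) p.1 * Real.exp (-V p.1)) ν' :=
        hint.mono_measure (Measure.restrict_mono hsub le_rfl)
      have hbd : ∀ p : M × ℝ, ‖Q p.2 p.1 * wZ k p.1‖ ≤
          C₀ / ((k : ℝ) + 1) ^ 2 * (g.gradSq (ρ p.2) p.1 * Real.exp (-V p.1)) := by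
        intro p
        rw [Real.norm_eq_abs, abs_of_nonneg (mul_nonneg (g.gradSq_nonneg hg _ _)
          (mul_nonneg (g.gradSq_nonneg hg _ _) (Real.exp_pos _).le))]
        change g.gradSq (ρ p.2) p.1 * (g.gradSq (η k) p.1 * Real.exp (-V p.1)) ≤ _
        have h2 := hηgrad k p.1
        have hq : 0 ≤ g.gradSq (ρ p.2) p.1 * Real.exp (-V p.1) :=
          mul_nonneg (g.gradSq_nonneg hg _ _) (Real.exp_pos _).le
        calc g.gradSq (ρ p.2) p.1 * (g.gradSq (η k) p.1 * Real.exp (-V p.1))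
            = g.gradSq (η k) p.1 * (g.gradSq (ρ p.2) p.1 * Real.exp (-V p.1)) := by ring
          _ ≤ C₀ / ((k : ℝ) + 1) ^ 2 * (g.gradSq (ρ p.2) p.1 * Real.exp (-V p.1)) :=
              mul_le_mul_of_nonneg_right h2 hq
      have hstrip_le : ∫ p, Q p.2 p.1 * wZ k p.1 ∂ν' ≤ C₀ / ((k : ℝ) + 1) ^ 2 * B := by
        calc ∫ p, Q p.2 p.1 * wZ k p.1 ∂ν' ≤ ∫ p, ‖Q p.2 p.1 * wZ k p.1‖ ∂ν' :=
              (Real.le_norm_self _).trans (norm_integral_le_integral_norm _)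
          _ ≤ ∫ p, C₀ / ((k : ℝ) + 1) ^ 2 * (g.gradSq (ρ p.2) p.1 * Real.exp (-V p.1)) ∂ν' :=
              integral_mono_of_nonneg (Eventually.of_forall fun p ↦ norm_nonneg _) (hint'.const_mul _)
                (Eventually.of_forall hbd)
          _ = C₀ / ((k : ℝ) + 1) ^ 2 * ∫ p, g.gradSq (ρ p.2) p.1 * Real.exp (-V p.1) ∂ν' :=
              integral_const_mul _ _
          _ ≤ C₀ / ((k : ℝ) + 1) ^ 2 * B := by
              refine mul_le_mul_of_nonneg_left ?_ (hCk k)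
              exact integral_mono_measure (Measure.restrict_mono hsub le_rfl)
                (Eventually.of_forall fun p ↦ mul_nonneg (g.gradSq_nonneg hg _ _) (Real.exp_pos _).le) hint
      calc E k s₀ = ∫ s in (0 : ℝ)..s₀, E' k s := by rw [hFTC, hE0, sub_zero]
        _ ≤ ∫ s in (0 : ℝ)..s₀, 2 * CT * Z k s :=
            intervalIntegral.integral_mono_on hs₀.1 hE'i hZi2 fun s hs ↦ hE'le k s ⟨hs.1, hs.2.trans hs₀.2⟩
        _ = 2 * CT * ∫ s in (0 : ℝ)..s₀, Z k s := intervalIntegral.integral_const_mul _ _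
        _ = 2 * CT * ∫ p, Q p.2 p.1 * wZ k p.1 ∂ν' := by rw [hZF]
        _ ≤ 2 * CT * (C₀ / ((k : ℝ) + 1) ^ 2 * B) := mul_le_mul_of_nonneg_left hstrip_le (by positivity)
  -- the bound tends to `0`
  have hlim : Tendsto (fun k : ℕ ↦ 2 * CT * (C₀ / ((k : ℝ) + 1) ^ 2 * B)) atTop (𝓝 0) := by
    have h1 : Tendsto (fun k : ℕ ↦ ((k : ℝ) + 1) ^ 2) atTop atTop :=
      (tendsto_pow_atTop two_ne_zero).comp
        (tendsto_atTop_add_const_right _ 1 (tendsto_natCast_atTop_atTop (R := ℝ)))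
    have h2 : Tendsto (fun k : ℕ ↦ C₀ / ((k : ℝ) + 1) ^ 2) atTop (𝓝 0) :=
      tendsto_const_nhds.div_atTop h1
    simpa using (h2.mul_const B).const_mul (2 * CT)
  -- every energy vanishes at `s₀`
  have hs₀O := hTO hs₀
  have hFsc : Continuous (F s₀) := hΨc.comp (hws s₀ hs₀O).continuous
  have hF0 : ∀ x, 0 ≤ F s₀ x := fun x ↦ (hΨbd _).1
  have hEi : ∀ k, Integrable (fun x ↦ F s₀ x * h k x) μ := fun k ↦
    integrable_of_continuous_of_hasCompactSupport' hg (hFsc.mul (hhc k)) ((hhs k).mul_left)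
  have hEmono : ∀ k j, k ≤ j → E k s₀ ≤ E j s₀ := by
    intro k j hkj
    refine integral_mono (hEi k) (hEi j) fun x ↦ ?_
    have hηle : η k x ≤ η j x := (monotone_nat_of_le_succ fun m ↦ hηmono m x) hkj
    have hη2le : η k x ^ 2 ≤ η j x ^ 2 := pow_le_pow_left₀ (hη01 k x).1 hηle 2
    exact mul_le_mul_of_nonneg_left (mul_le_mul_of_nonneg_right hη2le (Real.exp_pos _).le) (hF0 x)
  have hEzero : ∀ k, E k s₀ = 0 := by
    intro k
    refine le_antisymm ?_ (integral_nonneg fun x ↦ mul_nonneg (hF0 x) (hh0 k x))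
    exact ge_of_tendsto hlim (eventually_atTop.2 ⟨k, fun j hj ↦ (hEmono k j hj).trans (hEbound j)⟩)
  -- conclusion at `x₀`
  obtain ⟨k, hk1⟩ := (hη1 x₀).exists
  have hcont : Continuous fun x ↦ F s₀ x * h k x := hFsc.mul (hhc k)
  have hnn : 0 ≤ fun x ↦ F s₀ x * h k x := fun x ↦ mul_nonneg (hF0 x) (hh0 k x)
  have hae := (integral_eq_zero_iff_of_nonneg hnn (hEi k)).1 (hEzero k)
  have heq0 := (hcont.ae_eq_iff_eq μ continuous_const).1 hae
  have hx : F s₀ x₀ * h k x₀ = 0 := congr_fun heq0 x₀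
  have hpos : 0 < h k x₀ := by simp only [hh, hk1, one_pow, one_mul]; exact Real.exp_pos _
  have hΨ0 : Ψ (w s₀ x₀) = 0 := by
    rcases mul_eq_zero.1 hx with h0 | h0
    · exact h0
    · exact absurd h0 hpos.ne'
  have hwle : w s₀ x₀ ≤ 0 := hΨzero _ hΨ0
  -- `e^{2Ks₀}|∇ρ(s₀)|² ≤ G₀`
  have hle : ex s₀ * g.gradSq (ρ s₀) x₀ ≤ G₀ := by
    simp only [hwdef, hQdef] at hwle; linarith
  have hexpos : 0 < ex s₀ := Real.exp_pos _
  have hinv : Real.exp (-2 * K * s₀) * ex s₀ = 1 := by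
    simp only [hex, ← Real.exp_add]; rw [show -2 * K * s₀ + 2 * K * s₀ = 0 by ring, Real.exp_zero]
  calc g.gradSq (ρ s₀) x₀ = Real.exp (-2 * K * s₀) * (ex s₀ * g.gradSq (ρ s₀) x₀) := by
        rw [← mul_assoc, hinv, one_mul]
    _ ≤ Real.exp (-2 * K * s₀) * G₀ := mul_le_mul_of_nonneg_left hle (Real.exp_pos _).le

end Gradient

end Summit.SmoothPoincare4.SmoothPoincare4.Theorems.BakryEmeryComplete

end
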